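import Literature.AnabelianGeometry.AbsoluteAnabelian.AbsTopII.InertiaGroups

/-!
# [AbsTopII] Prop 1.3 (iii), the cusp clause with the PRINTED conjugacy scope (`Prop_1_3_iii''`)

S. Mochizuki, *Topics in Absolute Anabelian Geometry II* [AbsTopII] (bib `MochizukiAbsTopII2013`;
locators = PDF pages of the kurims manuscript `paper:url-585b8d0ad0d9`), §1, Def 1.2 (ii) p. 10,
Prop 1.3 (iii) p. 11:

> "(iii) If `v` is a vertex of `𝔾`, then we have a natural isomorphism `I_v ⥲ I`; `D_v ∩ Π_I = I_v × Π_v`;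
> as abstract profinite groups, `I_v ≅ Ẑ^Σ`.  If `e` is a cusp that abuts to `v`, then [for appropriate
> choices of conjugates of the various inertia and decomposition groups involved] we have inclusions
> `I_e, I_v ⊆ D_e ∩ Π_I`, and the natural morphism `I_e × I_v → D_e ∩ Π_I` is an isomorphism; in
> particular, as abstract profinite groups, `D_e ∩ Π_I ≅ Ẑ^Σ × Ẑ^Σ`, and we have a natural exact
> sequence `1 → I_e → D_e ∩ Π_I → I → 1`."

and Def 1.2 (ii) p. 10: "each vertex `v` (respectively, edge `e`) of `𝔾` determines [up to conjugation
in `Π_𝔾`] a subgroup `Π_v ⊆ Π_𝔾` (respectively, `Π_e ⊆ Π_𝔾`)".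

Statements file (1 predicate), abc-iut-L4-t6 lineage (typer of record of Prop 1.3 (iii) (rest):
`DPSCIndexData.Prop_1_3_iii'`, `AbsTopII/InertiaGroups.lean` p405221), cell row «P13iii-SCOPE»
(abc-iut-L4-lead RULING #8e (4)).  The v1 predicate `Prop_1_3_iii'` renders "[for appropriate choices of
conjugates …]" in the cusp clause by `∃ g : Π_H` — a conjugating element ranging over ALL of `Π_H`.  Print
fixes `Π_v`, `Π_e` (hence `I_v`, `D_e`) up to conjugation IN `Π_𝔾` (Def 1.2 (ii)), so the appropriate
conjugates are `Π_𝔾`-conjugates `γ·I_v·γ⁻¹`, `γ ∈ Π_𝔾`: the v1 form is MORE PERMISSIVE than print (it is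
implied by, and does not imply, the printed form).  This is the same scope convention (erratum E-L4-9) as
abc-iut-L4-t4's `DPSCData.Prop13iv'` (p425881) and this lineage's `Prop_1_3_viii'` / `Prop_1_3_x'`
(`AbsTopII/InertiaGroupsScope.lean`, p427207) and `Prop_1_3_ii'` (`AbsTopII/InertiaGroupsBranchScope.lean`),
where the v1 `Π_H`-scope was too STRONG; here it is too WEAK, so the repair is debt-only
(`Prop_1_3_iii'' → Prop_1_3_iii'`, companion `AbsTopII/InertiaGroupsCuspScopeProofs.lean`).  The vertex
clauses are those of `Prop_1_3_iii'` verbatim.  HONEST FRAMING: a PREDICATE on abstract DPSC data (Def 1.2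
(ii)), asserted by print for the data arising from a stable log curve over a log point; typed ≠ proved;
nothing here bears on [IUTchIII] Cor 3.12.
-/

open scoped Pointwise

universe u

namespace Literature.AnabelianGeometry.AbsoluteAnabelian.AbsTopII

namespace DPSCIndexData

variable (X : DPSCIndexData.{u})

/-- **Prop 1.3 (iii)** p. 11, the clauses not in `DPSCData.Prop13iii`, PRINTED CONJUGACY SCOPE (v2 of
`Prop_1_3_iii'`; vertex `v`, cusp `e` abutting to `v = X.cuspVert e`): "`D_v ∩ Π_I = I_v × Π_v`; as
abstract profinite groups, `I_v ≅ Ẑ^Σ`.  If `e` is a cusp that abuts to `v`, then [for appropriate choices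
of conjugates of the various inertia and decomposition groups involved] we have inclusions
`I_e, I_v ⊆ D_e ∩ Π_I`, and the natural morphism `I_e × I_v → D_e ∩ Π_I` is an isomorphism; in
particular, [...] we have a natural exact sequence `1 → I_e → D_e ∩ Π_I → I → 1`" (`I_e = (D_e ∩ Π_I) ∩ Π_𝔾`,
`(D_e ∩ Π_I) · Π_𝔾 = Π_I`) — the appropriate conjugate of `I_v` being a `Π_𝔾`-CONJUGATE `γ·I_v·γ⁻¹`,
`γ ∈ Π_𝔾`, since "each vertex `v` … determines [up to conjugation in `Π_𝔾`] a subgroup `Π_v ⊆ Π_𝔾`"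
(Def 1.2 (ii) p. 10).  Supersedes `Prop_1_3_iii'` (whose `∃ g : Π_H` it implies) for consumers.
[cite: MochizukiAbsTopII2013, Prop 1.3 (iii) p.11] -/
def Prop_1_3_iii'' : Prop :=
  (∀ v : X.Vert, IsInternalProduct (X.Iv v) (X.vertSub v) (X.Dv v ⊓ X.PiI) ∧
    IsFreeProSigmaCyclic X.Sigma ↥(X.Iv v)) ∧
  ∀ e : X.Cusp, ∃ γ : X.PiH, γ ∈ X.PiG ∧
    IsInternalProduct (X.IvCusp e) (MulAut.conj γ • X.Iv (X.cuspVert e)) (X.DvCusp e ⊓ X.PiI) ∧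
    (X.DvCusp e ⊓ X.PiI) ⊓ X.PiG = X.IvCusp e ∧ (X.DvCusp e ⊓ X.PiI) ⊔ X.PiG = X.PiI

end DPSCIndexData

end Literature.AnabelianGeometry.AbsoluteAnabelian.AbsTopII
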